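import Summits.HodgeConjecture.CorCM.CyclicTimesPrimeCMTypes
import HarnessLib

/-!
# Odd character sums over CM halves of a cyclic group of order `2^{a+1} q`: a vanishing sum forces `q`-periodicity

COR-CM (cell `pub-hodgecm2`), binder seat b04 (gen 20), count-neutral claim DICYCLIC-TWO-SHEET, part III; the exact
residue of gen 11's `CyclicTwoPower.sum_ne_zero_of_orderOf_eq_two_pow_mul_prime` (`CorCM/CyclicTimesPrimeCMTypes`:
no odd character vanishes on a PRIMITIVE CM type of a cyclic group of order `2^{a+1} q`).  KERNEL ONLY: theorems; no
definition, no named fact, no `sorry`.  `HC_CM` is neither used nor claimed.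

THEOREM (`mul_pow_mem_iff_of_sum_eq_zero`).  `G` cyclic, generated by `γ` of order `2^{a+1} q` with `q` an odd
prime; `Φ ⊆ G` a CM half for the involution `ρ` (one of `g, ρ g` for every `g`); `χ` an ODD character
(`χ(ρ) = -1`).  If `Σ_{s∈Φ} χ(s) = 0` then `Φ` is stable under the element `γ_q = γ^{2^{a+1}}` of order `q`:
`g ∈ Φ ↔ g γ_q ∈ Φ` for every `g` — so `Φ` has a non-trivial stabiliser (and is imprimitive; with primitivity this is
gen 11's theorem).  PROOF = gen 11's: `χ(γ^{qr + 2m s}) = ω^r ζ^s` (`ω^m = -1`, `m = 2^a`, `ζ^q = 1`),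
`Σ_Φ χ = Σ_{r<m, s<q} ε_{rs} ω^r ζ^s` with signs `ε_{rs}`; `ζ = 1` is impossible (coefficients = sums of `q` signs,
odd, against the minimal polynomial `X^m + 1` of `ω`); `ζ ≠ 1` is a primitive `q`-th root and
`forall_eq_of_sum_monomials_eq_zero` (linear disjointness of `ℚ(ζ_{2m})`, `ℚ(ζ_q)`) makes `ε_{rs}` independent of `s`.
Used in part IV on BOTH SHEETS of a CM type of a dicyclic Galois group, where neither sheet need be primitive.

## References

* [Kubota1965] T. Kubota, Trans. AMS 118 (1965), §4 Lemma 2.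
* [Washington1997] L. C. Washington, *Introduction to Cyclotomic Fields*, Prop. 2.4, Thm. 2.5.
* [Gordon1999HodgeAVSurvey] B. B. Gordon, *A survey of the Hodge conjecture for abelian varieties*, Prop. 9.4.1, §9.4.2.
-/

noncomputable section

open Polynomial

namespace Summit.HodgeConjecture.CorCM.CyclicTwoPower

open Literature.NumberTheory.ComplexMultiplication

section Group

variable {G : Type*} [Group G] [Fintype G] [DecidableEq G]

/-- **A vanishing odd character sum over a CM half of a cyclic group of order `2^{a+1} q` (`q` an odd prime) forces
stability under the element `γ^{2^{a+1}}` of order `q`.** [cite: Kubota1965, §4 Lemma 2]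
[cite: Washington1997, Thm. 2.5] -/
theorem mul_pow_mem_iff_of_sum_eq_zero {γ ρ : G} {a q : ℕ} (hq : q.Prime) (hq2 : q ≠ 2)
    (hγ : orderOf γ = 2 ^ (a + 1) * q) (hgen : ∀ x : G, x ∈ Submonoid.powers γ) {Φ : Finset G}
    (hΦ : IsCMTypeWith ρ (Φ : Set G)) (χ : AddChar (Additive G) ℂ) (hχ : χ (Additive.ofMul ρ) = -1)
    (h0 : ∑ s ∈ Φ, χ (Additive.ofMul s) = 0) : ∀ g : G, g ∈ Φ ↔ g * γ ^ 2 ^ (a + 1) ∈ Φ := by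
  classical
  set m : ℕ := 2 ^ a with hm_def
  have hm : 0 < m := by positivity
  have hq1 : 1 < q := hq.one_lt
  have h2m : 2 * m = 2 ^ (a + 1) := by rw [hm_def, pow_succ, mul_comm]
  have hγ' : orderOf γ = 2 * m * q := by rw [h2m, hγ]
  have hγ2 : orderOf γ = 2 * (m * q) := by rw [hγ', mul_assoc]
  have hcop : (2 * m).Coprime q := by
    rw [h2m]; exact Nat.Coprime.pow_left _ ((Nat.coprime_primes Nat.prime_two hq).2 (Ne.symm hq2))
  -- the involution `ρ = γ^{mq} = γ₂^m`
  have hρ1 : ρ ≠ 1 := by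
    intro h; have := hΦ.rho_smul_ne (1 : G); rw [h, smul_eq_mul, one_mul] at this; exact this rfl
  have hρ2 : ρ * ρ = 1 := by have := hΦ.invol (1 : G); simpa [smul_eq_mul] using this
  have hρ : ρ = γ ^ (m * q) := involution_eq_pow hγ2 hgen hρ1 hρ2
  -- `γ₂ = γ^q`, `γ_q = γ^(2m)`
  obtain ⟨γ₂, hγ₂⟩ : ∃ g : G, g = γ ^ q := ⟨_, rfl⟩
  obtain ⟨γq, hγq⟩ : ∃ g : G, g = γ ^ (2 * m) := ⟨_, rfl⟩
  have hρ' : ρ = γ₂ ^ m := by rw [hρ, hγ₂, ← pow_mul γ q m, mul_comm]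
  have hγqq : γq ^ q = 1 := by
    rw [hγq, ← pow_mul γ (2 * m) q]
    exact orderOf_dvd_iff_pow_eq_one.1 (hγ' ▸ dvd_refl _)
  -- `ω = χ(γ₂)`, `ζ = χ(γ_q)`
  set ω : ℂ := χ (Additive.ofMul γ₂) with hω_def
  set ζ : ℂ := χ (Additive.ofMul γq) with hζ_def
  have hχ2 : ∀ i j : ℕ, χ (Additive.ofMul (γ₂ ^ i * γq ^ j)) = ω ^ i * ζ ^ j := fun i j => by
    rw [ofMul_mul, AddChar.map_add_eq_mul, ofMul_pow, ofMul_pow, AddChar.map_nsmul_eq_pow,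
      AddChar.map_nsmul_eq_pow]
  have hωm : ω ^ m = -1 := by
    have := hχ2 m 0
    rw [pow_zero, mul_one, pow_zero, mul_one, ← hρ', hχ] at this
    exact this.symm
  have hζq : ζ ^ q = 1 := by
    have := hχ2 0 q
    rw [pow_zero, one_mul, pow_zero, one_mul, hγqq, ofMul_one, AddChar.map_zero_eq_one] at this
    exact this.symm
  -- signs
  let ε : ℕ → ℕ → ℚ := fun r s => if γ₂ ^ r * γq ^ s ∈ Φ then 1 else -1
  have hε : ∀ r s, ε r s = 1 ∨ ε r s = -1 := fun r s => by simp only [ε]; split_ifs <;> simp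
  -- pairing under `ρ`
  have hpair : ∀ r s : ℕ, (γ₂ ^ (r + m) * γq ^ s ∈ Φ ↔ γ₂ ^ r * γq ^ s ∉ Φ) := fun r s => by
    have h := hΦ.rho_smul_mem_iff (γ₂ ^ r * γq ^ s)
    rw [smul_eq_mul, hρ', ← mul_assoc, ← pow_add, add_comm, Finset.mem_coe, Finset.mem_coe] at h
    exact h
  -- reindexing `G` by `(Fin m × Fin q) ⊕ (Fin m × Fin q)`
  have hcardG : Fintype.card G = 2 * m * q := by
    have h := orderOf_eq_card_of_forall_mem_powers hgen
    rw [Nat.card_eq_fintype_card] at h; rw [← h, hγ']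
  let e : (Fin m × Fin q) ⊕ (Fin m × Fin q) → G := fun x =>
    Sum.elim (fun rs : Fin m × Fin q => γ₂ ^ (rs.1 : ℕ) * γq ^ (rs.2 : ℕ))
      (fun rs : Fin m × Fin q => γ₂ ^ ((rs.1 : ℕ) + m) * γq ^ (rs.2 : ℕ)) x
  have hpow : ∀ i j : ℕ, γ₂ ^ i * γq ^ j = γ ^ (q * i + 2 * m * j) := fun i j => by
    rw [hγ₂, hγq, ← pow_mul γ q i, ← pow_mul γ (2 * m) j, ← pow_add]
  have hinj : Function.Injective e := by
    rintro (rs | rs) (rs' | rs') h <;>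
      dsimp only [e, Sum.elim_inl, Sum.elim_inr] at h <;> rw [hpow, hpow] at h
    · have hb := rs.1.2; have hb' := rs'.1.2
      obtain ⟨h1, h2⟩ := exponents_eq_of_pow_eq hγ' hcop (by omega) (by omega) rs.2.2 rs'.2.2 h
      exact congrArg Sum.inl (Prod.ext (Fin.ext h1) (Fin.ext h2))
    · have hb := rs.1.2; have hb' := rs'.1.2
      obtain ⟨h1, -⟩ := exponents_eq_of_pow_eq hγ' hcop (by omega) (by omega) rs.2.2 rs'.2.2 h; omega
    · have hb := rs.1.2; have hb' := rs'.1.2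
      obtain ⟨h1, -⟩ := exponents_eq_of_pow_eq hγ' hcop (by omega) (by omega) rs.2.2 rs'.2.2 h; omega
    · have hb := rs.1.2; have hb' := rs'.1.2
      obtain ⟨h1, h2⟩ := exponents_eq_of_pow_eq hγ' hcop (by omega) (by omega) rs.2.2 rs'.2.2 h
      exact congrArg Sum.inr (Prod.ext (Fin.ext (by omega)) (Fin.ext h2))
  have hbij : Function.Bijective e := by
    rw [Fintype.bijective_iff_injective_and_card]
    refine ⟨hinj, ?_⟩
    rw [Fintype.card_sum, Fintype.card_prod, Fintype.card_fin, Fintype.card_fin, hcardG]; ring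
  -- the sum
  have hsum : ∑ s ∈ Φ, χ (Additive.ofMul s) =
      ∑ r ∈ Finset.range m, ∑ s ∈ Finset.range q, (ε r s : ℂ) * (ω ^ r * ζ ^ s) := by
    have h1 : ∑ s ∈ Φ, χ (Additive.ofMul s) = ∑ g : G, if g ∈ Φ then χ (Additive.ofMul g) else 0 := by
      rw [← Finset.sum_filter, Finset.filter_mem_eq_inter, Finset.univ_inter]
    have h2 : (∑ g : G, if g ∈ Φ then χ (Additive.ofMul g) else 0) =
        ∑ x : (Fin m × Fin q) ⊕ (Fin m × Fin q), if e x ∈ Φ then χ (Additive.ofMul (e x)) else 0 :=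
      (Fintype.sum_bijective e hbij (fun x => if e x ∈ Φ then χ (Additive.ofMul (e x)) else 0)
        (fun g => if g ∈ Φ then χ (Additive.ofMul g) else 0) fun _ => rfl).symm
    rw [h1, h2, Fintype.sum_sum_type, ← Finset.sum_add_distrib, Fintype.sum_prod_type, Finset.sum_range]
    refine Finset.sum_congr rfl fun r _ => ?_
    rw [Finset.sum_range]
    refine Finset.sum_congr rfl fun s _ => ?_
    change ((if γ₂ ^ (r : ℕ) * γq ^ (s : ℕ) ∈ Φ then χ (Additive.ofMul (γ₂ ^ (r : ℕ) * γq ^ (s : ℕ))) else 0) +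
        if γ₂ ^ ((r : ℕ) + m) * γq ^ (s : ℕ) ∈ Φ then χ (Additive.ofMul (γ₂ ^ ((r : ℕ) + m) * γq ^ (s : ℕ)))
        else 0) = (ε r s : ℂ) * (ω ^ (r : ℕ) * ζ ^ (s : ℕ))
    rw [hχ2, hχ2, pow_add ω (r : ℕ) m, hωm]
    by_cases hi : γ₂ ^ (r : ℕ) * γq ^ (s : ℕ) ∈ Φ
    · have hi' : γ₂ ^ ((r : ℕ) + m) * γq ^ (s : ℕ) ∉ Φ := fun h => (hpair r s).1 h hi
      simp only [hi, hi', if_true, if_false, ε]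
      push_cast; ring
    · have hi' : γ₂ ^ ((r : ℕ) + m) * γq ^ (s : ℕ) ∈ Φ := (hpair r s).2 hi
      simp only [hi, hi', if_true, if_false, ε]
      push_cast; ring
  rw [hsum] at h0
  -- membership read on the signs
  have hmemε : ∀ r s : ℕ, (γ₂ ^ r * γq ^ s ∈ Φ ↔ ε r s = 1) := fun r s => by
    simp only [ε]
    split_ifs with h
    · simp [h]
    · simp only [h, false_iff]; norm_num
  rcases hq.eq_one_or_self_of_dvd (orderOf ζ) (orderOf_dvd_of_pow_eq_one hζq) with h1 | h2
  · -- `ζ = 1`: the coefficient of `ω^r` is a sum of `q` signs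
    have hζ1 : ζ = 1 := orderOf_eq_one_iff.1 h1
    let P : ℚ[X] := ∑ r ∈ Finset.range m, monomial r (∑ s ∈ Finset.range q, ε r s)
    have hP0 : P ≠ 0 := by
      intro h
      have h0 : P.coeff 0 = ∑ s ∈ Finset.range q, ε 0 s := by
        simp only [P, finsetSum_coeff, coeff_monomial]
        rw [Finset.sum_eq_single 0 (fun i _ hi => if_neg hi) (fun h => absurd (Finset.mem_range.2 hm) h),
          if_pos rfl]
      rw [h, coeff_zero] at h0
      exact sum_signs_ne_zero (hq.odd_of_ne_two hq2) (ε 0) (hε 0) h0.symm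
    have hPdeg : P.natDegree < m := by
      have h1 : P.natDegree ≤ m - 1 :=
        natDegree_sum_le_of_forall_le _ _ fun i hi =>
          (natDegree_monomial_le _).trans (by have := Finset.mem_range.1 hi; omega)
      omega
    have hPeval : aeval ω P = ∑ r ∈ Finset.range m, ∑ s ∈ Finset.range q, (ε r s : ℂ) * ω ^ r := by
      simp only [P, map_sum, aeval_monomial, eq_ratCast]
    simp only [hζ1, one_pow, mul_one] at h0
    rw [← hPeval] at h0
    exact absurd h0 (aeval_ne_zero_of_pow_eq_neg_one hm_def hωm hP0 hPdeg)
  · -- `ζ` a primitive `q`-th root: the signs do not depend on `s`, so `Φ` is `γ_q`-stable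
    have hζprim : IsPrimitiveRoot ζ q := IsPrimitiveRoot.iff_orderOf.2 h2
    have hconst := forall_eq_of_sum_monomials_eq_zero hm_def hωm hq hq2 hζprim ε h0
    -- membership of `γ₂^r γq^s`, `r < m`, does not depend on `s`
    have hlow : ∀ r < m, ∀ s s' : ℕ, (γ₂ ^ r * γq ^ s ∈ Φ ↔ γ₂ ^ r * γq ^ s' ∈ Φ) := by
      intro r hr s s'
      rw [pow_eq_pow_mod s hγqq, pow_eq_pow_mod s' hγqq, hmemε, hmemε,
        hconst r hr _ (Nat.mod_lt _ (by omega)), hconst r hr _ (Nat.mod_lt _ (by omega))]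
    have hall : ∀ g : G, (g ∈ Φ ↔ g * γq ∈ Φ) := by
      intro g
      obtain ⟨x, rfl⟩ := hbij.2 g
      rcases x with ⟨r, s⟩ | ⟨r, s⟩
      · change (γ₂ ^ (r : ℕ) * γq ^ (s : ℕ) ∈ Φ ↔ γ₂ ^ (r : ℕ) * γq ^ (s : ℕ) * γq ∈ Φ)
        rw [mul_assoc, ← pow_succ]
        exact hlow r r.2 _ _
      · change (γ₂ ^ ((r : ℕ) + m) * γq ^ (s : ℕ) ∈ Φ ↔ γ₂ ^ ((r : ℕ) + m) * γq ^ (s : ℕ) * γq ∈ Φ)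
        rw [mul_assoc, ← pow_succ, hpair, hpair, hlow r r.2 (s : ℕ) ((s : ℕ) + 1)]
    intro g
    rw [← h2m, ← hγq]
    exact hall g


omit [Fintype G] [DecidableEq G] in
/-- Order of the stabilising element: `γ^{2^{a+1}} ≠ 1` (it has order `q > 1`). [folklore] -/
theorem pow_two_pow_ne_one {γ : G} {a q : ℕ} (hq : q.Prime) (hγ : orderOf γ = 2 ^ (a + 1) * q) :
    γ ^ 2 ^ (a + 1) ≠ 1 := by
  refine pow_ne_one_of_lt_orderOf (by positivity) ?_
  rw [hγ]
  have := hq.one_lt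
  have h2 : 0 < 2 ^ (a + 1) := by positivity
  nlinarith

/-- **Contrapositive, stabiliser form**: if `Φ` is NOT stable under `γ^{2^{a+1}}` then no odd character vanishes on
it. [cite: Kubota1965, §4 Lemma 2] -/
theorem sum_ne_zero_of_not_forall_mul_pow_mem_iff {γ ρ : G} {a q : ℕ} (hq : q.Prime) (hq2 : q ≠ 2)
    (hγ : orderOf γ = 2 ^ (a + 1) * q) (hgen : ∀ x : G, x ∈ Submonoid.powers γ) {Φ : Finset G}
    (hΦ : IsCMTypeWith ρ (Φ : Set G)) (hns : ¬ ∀ g : G, g ∈ Φ ↔ g * γ ^ 2 ^ (a + 1) ∈ Φ)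
    (χ : AddChar (Additive G) ℂ) (hχ : χ (Additive.ofMul ρ) = -1) :
    ∑ s ∈ Φ, χ (Additive.ofMul s) ≠ 0 := fun h0 =>
  hns (mul_pow_mem_iff_of_sum_eq_zero hq hq2 hγ hgen hΦ χ hχ h0)

end Group

end Summit.HodgeConjecture.CorCM.CyclicTwoPower

end
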